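import Summits.HodgeConjecture.HodgeCM.Model.AdelicThetaDistributionFin34_1

/-! PORT of `HodgeCM/Model/AdelicThetaDistributionFin34.lean` (HodgeCMPerL run 82) — part 2: continuation of `Summits.HodgeConjecture.HodgeCM.Model.AdelicThetaDistributionFin34_1` (split at a top-level declaration boundary by port_pkg.py; scope re-opened below; declarations unchanged). -/

-- port_pkg: scope re-opened for this part (file-level context, then the namespace/section stack open at the cut)
set_option autoImplicit false
noncomputable section
open NumberField NumberField.mixedEmbedding IsDedekindDomain
open scoped Matrix TensorProduct Classical SchwartzMap
open Literature.NumberTheory.Automorphic Literature.NumberTheory.Weil1964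
open Literature.NumberTheory.GelbartRogawski1991 Literature.NumberTheory.GelbartRogawski1991.UnitaryDualPair
open Literature.RepresentationTheory (SeesawScalar.twist SeesawScalar.twist_apply)
open HodgeCM.Adelic HodgeCM.PerL34 HodgeCM.Model.ArchSideTerm
namespace HodgeCM.Model
namespace ThetaDistFin
variable {L : CMField} {ι₁ : L →+* ℂ} (V : HermSpace3 L ι₁) (S : StubTree.SeesawDatum L)
variable
  (hGR : (cmSplittingDatum (L : Type) finProdFinEquiv (frameD V) (frameD_real V) (frameD_ne V) (dW S) (dW_real S) (dW_ne S)).CompatibleSplitting)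
  (hGR₀ : (cmSplittingDatum (L : Type) (e₁) (frameD V) (frameD_real V) (frameD_ne V) (lineVec (L : Type) (dW S 0))
    (fun _ => dW_real S 0) (fun _ => dW_ne S 0)).CompatibleSplitting)
  (hGR₁ : (cmSplittingDatum (L : Type) (e₁) (frameD V) (frameD_real V) (frameD_ne V) (lineVec (L : Type) (dW S 1))
    (fun _ => dW_real S 1) (fun _ => dW_ne S 1)).CompatibleSplitting)
  (hGR₂ : (cmSplittingDatum (L : Type) (e₁) (frameD V) (frameD_real V) (frameD_ne V) (lineVec (L : Type) (dW' S 0))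
    (fun _ => dW'_real S 0) (fun _ => dW'_ne S 0)).CompatibleSplitting)
  (hGR₃ : (cmSplittingDatum (L : Type) (e₁) (frameD V) (frameD_real V) (frameD_ne V) (lineVec (L : Type) (dW' S 1))
    (fun _ => dW'_real S 1) (fun _ => dW'_ne S 1)).CompatibleSplitting)
  (η₀ η₁ η₂ η₃ : CMAdelic (L : Type) (frameD V) × CMAdelicOne (L : Type) →* ℂˣ)
  (hV : IsAnisotropic L V.Hm)
/-- **smoothness of the finite factor of slot 3**: every finite test function is fixed under `finRepThree (·, 1)` by an OPEN subgroup of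
`U(V)(𝔸_f)` — the pull-back along `finFrameCongr` of a deep principal congruence level (tree `…cmLineRepFin₁_thinCosetTestFunₗ_eq_self`
[GelbartRogawski1991 §3.1 Remark p. 457; Weil1964 n° 41 Thm 6] through the coset decomposition `exists_eq_sum_smul_finTranslateSB_indicatorSB` of
`Φ_f`, read back on the finite factor by `fin_V` and a nonzero archimedean vector `Φ₀`). -/
theorem finRepThree_smooth (hη₃c : Continuous fun p => ((η₃ p : ℂˣ) : ℂ))
    {Φ₀ : 𝓢((Fin 3 → mixedSpace (↥(maximalRealSubfield L))), ℂ)} (hΦ₀ : Φ₀ ≠ 0) (Φf : FinSB (↥(maximalRealSubfield L)) (Fin 3)) :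
    ∃ K : Subgroup ↥V.adelicFin, IsOpen (K : Set ↥V.adelicFin) ∧ ∀ g ∈ K, finRepThree V S hGR hGR₂ hGR₃ η₃ (g, 1) Φf = Φf := by
  -- a level of `Φf` and its coset decomposition
  obtain ⟨𝔫, -, hlev⟩ := exists_level_of_mem_schwartzBruhat (↥(maximalRealSubfield L)) Φf.2
  obtain ⟨s, hs⟩ := exists_eq_sum_smul_finTranslateSB_indicatorSB (piLevelIdeal (↥(maximalRealSubfield L)) (Fin 3) 𝔫)
    (isOpen_piLevelIdeal (↥(maximalRealSubfield L)) 𝔫) (isCompact_piLevelIdeal (↥(maximalRealSubfield L)) (Fin 3) 𝔫) Φf hlev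
  -- one deep level fixing every coset test function `Φ_∞ ⊗ 𝟙_{q + 𝔫𝒪̂³}`, `q ∈ s`
  obtain ⟨n₀, hn₀, hfix⟩ :=
    exists_nat_forall_dvd_finCongruenceLevel_forall_cmConjLineRepFin₁_thinCosetTestFunₗ_eq_self (L : Type) finProdFinEquiv e₁
      (frameD V) (frameD_real V) (frameD_ne V) (dW S) (dW_real S) (dW_ne S) (dW' S) (dW'_real S) (dW'_ne S) S.isoGL (isoGL_hg₀ S)
      hGR hGR₂ hGR₃ η₃
      hη₃c (A := ↥s) (fun q => (q.1.out : Fin 3 → FiniteAdeleRing (𝓞 ↥(maximalRealSubfield L)) ↥(maximalRealSubfield L)))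
      (fun _ => 𝔫)
  have hlvl : Ideal.span {((n₀ : ℕ) : 𝓞 (L : Type))} ≠ 0 := span_natCast_ne_zero (L := L) hn₀
  refine ⟨(UnitaryGroup.finCongruenceLevel (↥(maximalRealSubfield L)) (L : Type) (IsCMField.complexConj L) 3 (Matrix.diagonal (frameD V))
      (Ideal.span {((n₀ : ℕ) : 𝓞 (L : Type))})).comap (finFrameCongr (L : Type) V.Hm (frameG V) (frameD V) (frame_congr V)), ?_, ?_⟩
  · rw [Subgroup.coe_comap]
    exact (UnitaryGroup.isOpen_finCongruenceLevel (F := ↥(maximalRealSubfield L)) (E := (L : Type)) (c := IsCMField.complexConj L)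
      (N := 3) (J := Matrix.diagonal (frameD V)) hlvl).preimage (continuous_finFrameCongr (L : Type) V.Hm (frameG V) (frameD V) (frame_congr V))
  · intro g hg
    have hq : ∀ q ∈ s, finRepThree V S hGR hGR₂ hGR₃ η₃ (g, 1)
        (cosetIndicatorSB (↥(maximalRealSubfield L)) (Fin 3) (q.out : Fin 3 → FiniteAdeleRing (𝓞 ↥(maximalRealSubfield L)) _) 𝔫) =
        cosetIndicatorSB (↥(maximalRealSubfield L)) (Fin 3) (q.out : Fin 3 → FiniteAdeleRing (𝓞 ↥(maximalRealSubfield L)) _) 𝔫 := by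
      intro q hqs
      have h := hfix n₀ hn₀ (dvd_refl _) _ (Subgroup.mem_comap.mp hg) ⟨q, hqs⟩ Φ₀
      rw [thinCosetTestFunₗ_eq_tmul_cosetIndicatorSB, cmConjLineRepFin₁_finPairThree_tmul] at h
      exact tmul_left_cancel_fin hΦ₀ ((piSchwartzBruhatEquiv (↥(maximalRealSubfield L)) (Fin 3)).injective h)
    have hs' : Φf = ∑ q ∈ s, ((Φf : (Fin 3 → FiniteAdeleRing (𝓞 ↥(maximalRealSubfield L)) ↥(maximalRealSubfield L)) → ℂ) q.out) •
        cosetIndicatorSB (↥(maximalRealSubfield L)) (Fin 3) (q.out : Fin 3 → FiniteAdeleRing (𝓞 ↥(maximalRealSubfield L)) _) 𝔫 := hs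
    calc finRepThree V S hGR hGR₂ hGR₃ η₃ (g, 1) Φf
        = finRepThree V S hGR hGR₂ hGR₃ η₃ (g, 1)
            (∑ q ∈ s, ((Φf : (Fin 3 → FiniteAdeleRing (𝓞 ↥(maximalRealSubfield L)) ↥(maximalRealSubfield L)) → ℂ) q.out) •
              cosetIndicatorSB (↥(maximalRealSubfield L)) (Fin 3) (q.out : Fin 3 → FiniteAdeleRing (𝓞 ↥(maximalRealSubfield L)) _) 𝔫) := by
          rw [← hs']
      _ = ∑ q ∈ s, ((Φf : (Fin 3 → FiniteAdeleRing (𝓞 ↥(maximalRealSubfield L)) ↥(maximalRealSubfield L)) → ℂ) q.out) •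
              cosetIndicatorSB (↥(maximalRealSubfield L)) (Fin 3) (q.out : Fin 3 → FiniteAdeleRing (𝓞 ↥(maximalRealSubfield L)) _) 𝔫 := by
          rw [map_sum]
          exact Finset.sum_congr rfl fun q hq' => by rw [map_smul, hq q hq']
      _ = Φf := hs'.symm


end ThetaDistFin
end HodgeCM.Model

end
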